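import Mathlib
import HarnessLib
import Literature.Computability.AlgebraicComplexity.NilCoxeterTensor
import Literature.Computability.AlgebraicComplexity.PartialMatrixMultiplicationProofs
import Summits.MatrixMultiplication.MatrixMultiplication.Theses.NilCoxeterShadow

/-!
# `InductiveCosetGrowth → AThesis` — the glue `stmt-0958 ⟹ stmt-0956` of route `NilCoxeterShadow`

Crux `stmt-MatrixMultiplication-0956` (`AThesis` = X_NC: `∃ δ > 0, ∀ n₀, ∃ n ≥ n₀, (n!)^(1+δ) ≤ bR(T_{NC_n})`),
line `birth` (`Cruxes/AThesis/Lines/birth.lean`). This helper file (lands `--supports stmt-MatrixMultiplication-0956`)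
makes the route header's claim "InductiveCosetGrowth … implies X_NC" a kernel-checked implication between the two
route decls BY NAME, with NO further hypothesis: the flattening floor `n! ≤ bR(T_{NC_n})` of the skeleton
(`stub_flatteningFloor`) is replaced by the bare positivity `1 ≤ bR(T_{NC_n})` (`T_{NC_n} ≠ 0`, entry
`(e,e,e) = 1`; `one_le_algBorderRank_of_ne_zero`), as observed by the skeleton vet (VET.md / Weakened.lean,
2026-08-17). Writing `b n := bR(T_{NC_n}) = algBorderRank (nilCoxeterTensor ℂ n)`:

* `exists_superpolynomial_of_growth` — pure real analysis: `1 ≤ b n₀` and `(n+1)^(1+δ) · b n ≤ b (n+1)` for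
  `n ≥ n₀` give `(n!)^(1+δ/2) ≤ b n` for some `n ≥ N`, every `N` (induction
  `((n₀+k)!)^(1+δ) ≤ (n₀!)^(1+δ) · b (n₀+k)`, then `(n!)^(δ/2) ≥ n^(δ/2) ≥ (n₀!)^(1+δ)` once
  `n ≥ ((n₀!)^(1+δ))^(2/δ)`).
* `nilCoxeterTensor_ne_zero`, `one_le_algBorderRank_nilCoxeterTensor` — positivity.
* `aThesis_of_inductiveCosetGrowth : InductiveCosetGrowth → AThesis` — the glue, by the `rfl` bridge
  `nilCoxeterTensor_eq` between the Literature tensor and the route file's inlined tensor.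

Honest status (for planners): `InductiveCosetGrowth` (uniform gain `(n+1)^(1+δ)` at EVERY large step) is STRONGER
than `AThesis` (super-polynomial total, infinitely often); the converse implication is not claimed.
-/

-- `Summit.<Summit>.<Problem>`: for the single-conjunct summit the duplicate component is mandated.
set_option linter.dupNamespace false

namespace Summit.MatrixMultiplication.MatrixMultiplication.Theorems.AThesis

open Literature.Computability.AlgebraicComplexity
open Summit.MatrixMultiplication.MatrixMultiplication.Theses.NilCoxeterShadow

/-- **Accumulation lemma** (pure real analysis). If `1 ≤ b n₀` and `(n+1)^(1+δ) · b n ≤ b (n+1)` for all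
`n ≥ n₀` (`δ > 0`), then for every `N` there is `n ≥ N` with `(n!)^(1+δ/2) ≤ b n`.
Proof: by induction `((n₀+k)!)^(1+δ) ≤ (n₀!)^(1+δ) · b (n₀+k)`; for `n = n₀ + k ≥ ((n₀!)^(1+δ))^(2/δ)` one
has `(n!)^(δ/2) ≥ n^(δ/2) ≥ (n₀!)^(1+δ)`, so `(n!)^(1+δ/2) · (n₀!)^(1+δ) ≤ (n!)^(1+δ) ≤ (n₀!)^(1+δ) · b n`.
[folklore] -/
theorem exists_superpolynomial_of_growth (b : ℕ → ℝ) (n₀ : ℕ) (δ : ℝ) (hδ : 0 < δ)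
    (hbase : 1 ≤ b n₀)
    (hstep : ∀ n : ℕ, n₀ ≤ n → ((n : ℝ) + 1) ^ (1 + δ) * b n ≤ b (n + 1)) :
    ∀ N : ℕ, ∃ n : ℕ, N ≤ n ∧ (n.factorial : ℝ) ^ (1 + δ / 2) ≤ b n := by
  -- accumulated growth along the tower
  have hacc : ∀ k : ℕ, (((n₀ + k).factorial : ℕ) : ℝ) ^ (1 + δ) ≤
      ((n₀.factorial : ℕ) : ℝ) ^ (1 + δ) * b (n₀ + k) := by
    intro k
    induction k with
    | zero =>
      simp only [Nat.add_zero]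
      have h0 : (0 : ℝ) ≤ ((n₀.factorial : ℕ) : ℝ) ^ (1 + δ) := Real.rpow_nonneg (Nat.cast_nonneg _) _
      calc ((n₀.factorial : ℕ) : ℝ) ^ (1 + δ) = ((n₀.factorial : ℕ) : ℝ) ^ (1 + δ) * 1 := (mul_one _).symm
        _ ≤ ((n₀.factorial : ℕ) : ℝ) ^ (1 + δ) * b n₀ := mul_le_mul_of_nonneg_left hbase h0
    | succ k ih =>
      have hs := hstep (n₀ + k) (Nat.le_add_right _ _)
      have hfac : (((n₀ + (k + 1)).factorial : ℕ) : ℝ) =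
          (((n₀ + k : ℕ) : ℝ) + 1) * (((n₀ + k).factorial : ℕ) : ℝ) := by
        rw [← Nat.add_assoc, Nat.factorial_succ]
        push_cast
        ring
      have hpos1 : (0 : ℝ) ≤ ((n₀ + k : ℕ) : ℝ) + 1 := by positivity
      have hpos2 : (0 : ℝ) ≤ (((n₀ + k).factorial : ℕ) : ℝ) := Nat.cast_nonneg _
      have hpos3 : (0 : ℝ) ≤ ((n₀.factorial : ℕ) : ℝ) ^ (1 + δ) :=
        Real.rpow_nonneg (Nat.cast_nonneg _) _
      rw [hfac, Real.mul_rpow hpos1 hpos2]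
      calc (((n₀ + k : ℕ) : ℝ) + 1) ^ (1 + δ) * (((n₀ + k).factorial : ℕ) : ℝ) ^ (1 + δ)
          ≤ (((n₀ + k : ℕ) : ℝ) + 1) ^ (1 + δ) * (((n₀.factorial : ℕ) : ℝ) ^ (1 + δ) * b (n₀ + k)) :=
            mul_le_mul_of_nonneg_left ih (Real.rpow_nonneg hpos1 _)
        _ = ((n₀.factorial : ℕ) : ℝ) ^ (1 + δ) * ((((n₀ + k : ℕ) : ℝ) + 1) ^ (1 + δ) * b (n₀ + k)) := by
            ring
        _ ≤ ((n₀.factorial : ℕ) : ℝ) ^ (1 + δ) * b (n₀ + k + 1) := mul_le_mul_of_nonneg_left hs hpos3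
        _ = ((n₀.factorial : ℕ) : ℝ) ^ (1 + δ) * b (n₀ + (k + 1)) := by rw [Nat.add_assoc]
  -- choose `n = n₀ + k` beyond `N`, `n₀` and `((n₀!)^(1+δ))^(2/δ)`
  intro N
  have hMpos : (0 : ℝ) < ((n₀.factorial : ℕ) : ℝ) ^ (1 + δ) :=
    Real.rpow_pos_of_pos (by exact_mod_cast n₀.factorial_pos) _
  obtain ⟨L, hL⟩ := exists_nat_ge ((((n₀.factorial : ℕ) : ℝ) ^ (1 + δ)) ^ (2 / δ))
  obtain ⟨k, hk⟩ : ∃ k : ℕ, max (max N n₀) L = n₀ + k :=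
    Nat.exists_eq_add_of_le (le_trans (le_max_right _ _) (le_max_left _ _))
  refine ⟨n₀ + k, ?_, ?_⟩
  · calc N ≤ max (max N n₀) L := le_trans (le_max_left _ _) (le_max_left _ _)
      _ = n₀ + k := hk
  · have hLk' : L ≤ n₀ + k := hk ▸ le_max_right _ _
    have hLk : (L : ℝ) ≤ ((n₀ + k : ℕ) : ℝ) := by exact_mod_cast hLk'
    set F : ℝ := (((n₀ + k).factorial : ℕ) : ℝ) with hF
    set M : ℝ := ((n₀.factorial : ℕ) : ℝ) ^ (1 + δ) with hM
    have hFpos : 0 < F := by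
      rw [hF]
      exact_mod_cast (n₀ + k).factorial_pos
    have hFge : M ^ (2 / δ) ≤ F := by
      calc M ^ (2 / δ) ≤ L := hL
        _ ≤ ((n₀ + k : ℕ) : ℝ) := hLk
        _ ≤ F := by
            rw [hF]
            exact_mod_cast Nat.self_le_factorial _
    have hMF : M ≤ F ^ (δ / 2) := by
      have h1 : (M ^ (2 / δ)) ^ (δ / 2) ≤ F ^ (δ / 2) :=
        Real.rpow_le_rpow (Real.rpow_nonneg hMpos.le _) hFge (by positivity)
      have h2 : (M ^ (2 / δ)) ^ (δ / 2) = M := by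
        have hδ2 : (2 / δ) * (δ / 2) = 1 := by field_simp
        rw [← Real.rpow_mul hMpos.le, hδ2, Real.rpow_one]
      rw [h2] at h1
      exact h1
    have hA : F ^ (1 + δ) ≤ M * b (n₀ + k) := hacc k
    have h3 : F ^ (1 + δ / 2) * M ≤ b (n₀ + k) * M := by
      calc F ^ (1 + δ / 2) * M ≤ F ^ (1 + δ / 2) * F ^ (δ / 2) :=
            mul_le_mul_of_nonneg_left hMF (Real.rpow_nonneg hFpos.le _)
        _ = F ^ (1 + δ) := by
            rw [← Real.rpow_add hFpos]
            congr 1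
            ring
        _ ≤ M * b (n₀ + k) := hA
        _ = b (n₀ + k) * M := mul_comm _ _
    exact le_of_mul_le_mul_right h3 hMpos

/-- `T_{NC_n} ≠ 0`: the entry `(e, e, e)` is `1` (`T_e T_e = T_e`). [folklore] -/
theorem nilCoxeterTensor_ne_zero (n : ℕ) : nilCoxeterTensor ℂ n ≠ 0 := by
  intro h
  have h1 := congrFun (congrFun (congrFun h 1) 1) 1
  rw [nilCoxeterTensor_one_left, if_pos rfl] at h1
  exact one_ne_zero h1

/-- Positivity `1 ≤ bR(T_{NC_n})` (a nonzero tensor has border rank `≥ 1`). [folklore] -/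
theorem one_le_algBorderRank_nilCoxeterTensor (n : ℕ) : 1 ≤ algBorderRank (nilCoxeterTensor ℂ n) :=
  one_le_algBorderRank_of_ne_zero (nilCoxeterTensor_ne_zero n)

/-- **The glue `InductiveCosetGrowth → AThesis`** (route items stmt-MatrixMultiplication-0958 ⟹ 0956, both BY
NAME): a uniform multiplicative gain `(n+1)^(1+δ) · bR(T_{NC_n}) ≤ bR(T_{NC_{n+1}})` along the parabolic tower,
started from the positivity `1 ≤ bR(T_{NC_{n₀}})`, accumulates (`exists_superpolynomial_of_growth`) to
`(n!)^(1+δ/2) ≤ bR(T_{NC_n})` for infinitely many `n`; transported to the route's inlined tensor by the `rfl`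
bridge `nilCoxeterTensor_eq`. [folklore] -/
theorem aThesis_of_inductiveCosetGrowth : InductiveCosetGrowth → AThesis := by
  intro h
  have h' : ∃ δ : ℝ, 0 < δ ∧ ∃ n₀ : ℕ, ∀ n : ℕ, n₀ ≤ n →
      ((n : ℝ) + 1) ^ (1 + δ) * (algBorderRank (nilCoxeterTensor ℂ n) : ℝ) ≤
        (algBorderRank (nilCoxeterTensor ℂ (n + 1)) : ℝ) := h
  obtain ⟨δ, hδ, n₀, hstep⟩ := h'
  have hbase : (1 : ℝ) ≤ (algBorderRank (nilCoxeterTensor ℂ n₀) : ℝ) := by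
    exact_mod_cast one_le_algBorderRank_nilCoxeterTensor n₀
  have key : ∃ δ : ℝ, 0 < δ ∧ ∀ n₀ : ℕ, ∃ n : ℕ, n₀ ≤ n ∧
      (n.factorial : ℝ) ^ (1 + δ) ≤ (algBorderRank (nilCoxeterTensor ℂ n) : ℝ) :=
    ⟨δ / 2, half_pos hδ,
      exists_superpolynomial_of_growth (fun n => (algBorderRank (nilCoxeterTensor ℂ n) : ℝ)) n₀ δ hδ
        hbase hstep⟩
  exact key

end Summit.MatrixMultiplication.MatrixMultiplication.Theorems.AThesis
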